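import Summits.CriticalPhenomena.CardyFormulaZ2.Theorems.CardyBoundaryCoulombGasRectilinearCardyStubEventIdentityPart1
import Summits.CriticalPhenomena.CardyFormulaZ2.Theorems.CardyBoundaryCoulombGasBoundaryDefectGaussianRStubRealisabilityPart26

/-!
# Stub `stub_eventIdentity` of line `excursion-kernel-covariance` (crux `RectilinearCardy`,
# stmt-CriticalPhenomena-5660) — Part 2: untracked corners of the completed configuration
# (layer L2 / the model-free half of CLAIM C of the design `Lines/excursion-kernel-covariance-eventIdentity-design.md`)

For a general collar leg model `M` and live-open edges `ω ⊆ M.E`, with `β = M.cfgOf ω` the completed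
configuration and `σ = nextCorner β`:

* `ei_corner_eq` — every corner is `(toSite v, k)`;
* `ei_endpoints_mem_vertexCells` — the edges of `β` (live-open edges and frozen open edges) join
  VERTEX-CELLS (`dict_openEdges_endpoints`); `ei_vertexCells_of_cTgt_mem` — so a corner with an open
  target, and the far endpoint of that target, sit at vertex-cells;
* `ei_not_isTracked_next_of_mem` — an UNTRACKED corner with an open target leads to an untracked
  corner (the face is kept and is not a face-cell);
* `ei_untracked_to_tracked` — hence an untracked corner whose successor IS tracked has a CLOSED
  target, the successor is the next corner around the same vertex, which is a vertex-cell outside `V`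
  (a ghost), the old face is not a face-cell and the new one is;
* `ei_cfgOf_subset_edgeSet` — `β` is a lattice configuration; `ei_mem_periodicPts` — every corner is
  periodic under `σ` (its orbit only visits its own vertex and endpoints of the finitely many edges of
  `β`), so the tree's interface-loop library applies to every orbit loop of `β`.

All [folklore]; no new objects.
-/

namespace Summit.CriticalPhenomena.CardyFormulaZ2.Cruxes.RectilinearCardy.ExcursionKernelCovariance

open Finset Literature.Probability.LatticeModels Literature.Probability.LatticeModels.CollarLegModel
open Summit.CriticalPhenomena.CardyFormulaZ2.Cruxes.BoundaryDefectGaussianR.RainbowMonomialsInExcursionKernels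

section Untracked

variable {M : CollarLegModel} {ω : Finset ((ℤ × ℤ) × Bool)}

/-- Every corner is the corner `(toSite v, k)` of its lattice vertex `v = ofSite c.1`
(`toSite ∘ ofSite = id`). [folklore] -/
theorem ei_corner_eq (c : Site 2 × Fin 4) : c = (toSite (ofSite c.1), c.2) :=
  Prod.ext (by funext i; fin_cases i <;> simp [toSite, ofSite]) rfl

/-- **The edges of the completed configuration join vertex-cells**: a live-open edge (`ω ⊆ E`) joins
two vertices of `V`, a frozen open edge two vertex-cells. [folklore] -/
theorem ei_endpoints_mem_vertexCells (hω : ω ⊆ M.E) {e : (ℤ × ℤ) × Bool} (he : e ∈ ω ∨ e ∈ M.openEdges) :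
    e.1 ∈ M.vertexCells ∧ SixVertex.edgeTip e ∈ M.vertexCells := by
  rcases he with he | he
  · have hE := hω he
    rw [E, inducedEdges, mem_filter] at hE
    exact ⟨M.mem_vertexCells_of_mem hE.2.1, M.mem_vertexCells_of_mem hE.2.2⟩
  · exact dict_openEdges_endpoints M he

/-- **A corner with an open target sits at a vertex-cell, and so does the far endpoint of its
target** (`ofSite` of `c.1 + cornerUnit (c.2 + 1)` is `ofSite c.1 + dir (c.2 + 1)`). [folklore] -/
theorem ei_vertexCells_of_cTgt_mem (hω : ω ⊆ M.E) {c : Site 2 × Fin 4} (h : cTgt c ∈ M.cfgOf ω) :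
    ofSite c.1 ∈ M.vertexCells ∧ ofSite c.1 + dir (c.2 + 1) ∈ M.vertexCells := by
  obtain ⟨e, hc, hend⟩ := se_corner_edge (ofSite c.1) c.2
  rw [ei_corner_eq c] at h
  have he := (se_cTgt_mem_cfgOf_iff M ω hc).1 h
  obtain ⟨h1, h2⟩ := ei_endpoints_mem_vertexCells hω he
  rcases hend with ⟨ha, hb⟩ | ⟨ha, hb⟩
  · rw [ha] at h1; rw [hb] at h2; exact ⟨h1, h2⟩
  · rw [ha] at h1; rw [hb] at h2; exact ⟨h2, h1⟩

/-- **An untracked corner with an open target leads to an untracked corner**: the successor keeps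
the face, which is not a face-cell (the vertex being a vertex-cell by `ei_vertexCells_of_cTgt_mem`).
[folklore] -/
theorem ei_not_isTracked_next_of_mem (hω : ω ⊆ M.E) {c : Site 2 × Fin 4} (hc : ¬M.IsTracked c)
    (h : cTgt c ∈ M.cfgOf ω) : ¬M.IsTracked (nextCorner (M.cfgOf ω) c) := by
  intro ht
  apply hc
  refine ⟨(ei_vertexCells_of_cTgt_mem hω h).1, ?_⟩
  have hf : cFace (nextCorner (M.cfgOf ω) c) = cFace c := cFace_nextCorner_of_mem h
  rw [← hf]
  exact ht.2

/-- **From untracked to tracked only by turning around a ghost across a closed edge.** If `c` is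
untracked and its successor is tracked, then the target of `c` is CLOSED, the successor is the next
corner `(c.1, c.2 + 1)` around the same vertex, that vertex is a vertex-cell which is not in `V`
(a ghost), the face of `c` is not a face-cell and the face of the successor is. [folklore] -/
theorem ei_untracked_to_tracked {M : CollarLegModel} {ω : Finset ((ℤ × ℤ) × Bool)} (hω : ω ⊆ M.E)
    {c : Site 2 × Fin 4} (hc : ¬M.IsTracked c)
    (hn : M.IsTracked (nextCorner (M.cfgOf ω) c)) :
    cTgt c ∉ M.cfgOf ω ∧ nextCorner (M.cfgOf ω) c = (c.1, c.2 + 1) ∧ ofSite c.1 ∈ M.vertexCells ∧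
      ofSite c.1 ∉ M.V ∧ ofSite (cFace c) ∉ M.faceCells ∧ ofSite (cFace (c.1, c.2 + 1)) ∈ M.faceCells := by
  have hcl : cTgt c ∉ M.cfgOf ω := fun h => ei_not_isTracked_next_of_mem hω hc h hn
  have hnext : nextCorner (M.cfgOf ω) c = (c.1, c.2 + 1) := nextCorner_of_not_mem hcl
  rw [hnext] at hn
  have hx : ofSite c.1 ∈ M.vertexCells := hn.1
  have hV : ofSite c.1 ∉ M.V := fun hv => hc (perCfg_isTracked_of_mem_V M hv)
  have hf : ofSite (cFace c) ∉ M.faceCells := fun hf => hc ⟨hx, hf⟩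
  exact ⟨hcl, hnext, hx, hV, hf, hn.2⟩

/-- **The completed configuration is a lattice configuration**: its edges are edges of `ℤ²`. [folklore] -/
theorem ei_cfgOf_subset_edgeSet (M : CollarLegModel) (ω : Finset ((ℤ × ℤ) × Bool)) :
    (M.cfgOf ω : Set (Sym2 (Site 2))) ⊆ (zdGraph 2).edgeSet := by
  intro s hs
  rw [cfgOf, Finset.mem_coe, mem_image] at hs
  obtain ⟨e, -, rfl⟩ := hs
  rw [← cTgt_cIn e]
  exact cTgt_mem_edgeSet _

/-- The vertices visited by the orbit of a corner: its own vertex or an endpoint of an edge of the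
completed configuration. [folklore] -/
theorem ei_iterate_fst_mem (hω : ω ⊆ M.E) (c : Site 2 × Fin 4) (m : ℕ) :
    ((nextCorner (M.cfgOf ω))^[m] c).1 ∈
      insert c.1 ((M.vertexCells.image toSite : Finset (Site 2)) : Set (Site 2)) := by
  induction m with
  | zero => exact Set.mem_insert _ _
  | succ m ih =>
    rw [Function.iterate_succ_apply']
    set c' := (nextCorner (M.cfgOf ω))^[m] c
    by_cases hb : cTgt c' ∈ M.cfgOf ω
    · rw [nextCorner_of_mem hb]
      refine Set.mem_insert_of_mem _ ?_
      rw [Finset.coe_image, Set.mem_image]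
      refine ⟨ofSite c'.1 + dir (c'.2 + 1), (ei_vertexCells_of_cTgt_mem hω hb).2, ?_⟩
      rw [se_toSite_add_dir]
      congr 1
      funext i; fin_cases i <;> simp [toSite, ofSite]
    · rw [nextCorner_of_not_mem hb]
      exact ih

/-- **Every corner is periodic under the turning rule of the completed configuration** (its orbit
stays in the finite set of corners at its own vertex or at a vertex-cell; the turning rule is
injective). [folklore] -/
theorem ei_mem_periodicPts (hω : ω ⊆ M.E) (c : Site 2 × Fin 4) :
    c ∈ Function.periodicPts (nextCorner (M.cfgOf ω)) := by
  refine Literature.Probability.Percolation.mem_periodicPts_nextCorner_of_finite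
    (S := {q : Site 2 × Fin 4 | q.1 ∈ insert c.1 ((M.vertexCells.image toSite : Finset (Site 2)) : Set (Site 2))})
    ?_ (fun m => ei_iterate_fst_mem hω c m)
  have hfin : (insert c.1 ((M.vertexCells.image toSite : Finset (Site 2)) : Set (Site 2))).Finite :=
    (Finset.finite_toSet _).insert _
  exact (hfin.prod (Set.finite_univ (α := Fin 4))).subset fun q hq => ⟨hq, Set.mem_univ _⟩

end Untracked

end Summit.CriticalPhenomena.CardyFormulaZ2.Cruxes.RectilinearCardy.ExcursionKernelCovariance
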